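import Mathlib
import Literature.NumberTheory.Transcendental.ZagierDilogarithmConjecture
import Literature.NumberTheory.Transcendental.BlochWignerFiveTerm
import Literature.NumberTheory.Transcendental.BlochWignerDilogarithmVolumeProofs
import HarnessLib

/-!
# Kummer descent: 2-saturation + the unit-circle (Clausen) form ⇒ Zagier's dilogarithm conjecture

Stub `stub_kummerDescent` of the line `kummer-clausen-linearisation` for the crux
`ZagierDilogarithmConjecture` (stmt-KontsevichZagierPeriods-10550, route `HyperbolicBloch`).

Write `C := AddSubgroup.closure dilogRelators ⊆ ℤ[ℂ]` (`FreeAbelianGroup ℂ`) and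
`D := blochWignerDilog`. We prove the TRANSFER: if `C` is 2-saturated (`2x ∈ C → x ∈ C`) and
Zagier's conjecture holds for algebraic points of modulus one in the upper half plane (the
Clausen / Lobachevsky form: `Σ mⱼ D(uⱼ) = 0 ⇒ Σ mⱼ[uⱼ] ∈ C` for algebraic unimodular `uⱼ ∈ ℍ⁺`),
then Zagier's conjecture `ZagierDilogarithmRelationsConjecture` holds (we use its Bloch–Wigner
form `ZagierDilogarithmRelationsConjecture.iff_blochWignerDilog'`, proved in the tree).

Proof (Zagier 2007, Ch. I §3: Kummer's relation `2D(z) = D(z/z̄) + D((1−1/z)/(1−1/z̄)) +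
D((1/(1−z))/(1/(1−z̄)))`, the three arguments of modulus one; Neumann 1998 §2 for the relators):

* Kummer certificate (`kummer_mem_closure`): for algebraic `z ∉ ℝ`,
  `2[z] − [z/z̄] − [(1 − z⁻¹)/(1 − z̄⁻¹)] − [(1 − z̄)/(1 − z)] ∈ C`, the three arguments being
  algebraic of modulus one;
* normalisation to `ℍ⁺` (`exists_normalised`): for unimodular algebraic `u`,
  `[u] ≡ ε[w] (mod C)` with `w ∈ ℍ⁺` unimodular algebraic and `ε ∈ {0, ±1}`
  (`[u] + [ū] ∈ C`; `[r] ∈ C` for real `r`);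
* soundness (`lift_eq_zero_of_mem_closure`): the value homomorphism `[w] ↦ D(w)` kills `C`
  (Neumann's five-term relation for `D`, `D(z̄) = −D(z)`, `D|_ℝ = 0`), so the normalised
  unimodular combination `Y` replacing `2X`, `X = Σ nᵢ[zᵢ]`, has vanishing `D`-sum whenever
  `Σ nᵢ D(zᵢ) = 0`;
* the Clausen form puts `Y` in `C`, hence `2X = (2X − Y) + Y ∈ C`, and 2-saturation divides by `2`.
-/

noncomputable section

open scoped BigOperators ComplexConjugate
open Literature.NumberTheory.Transcendental

namespace Summit.KontsevichZagierPeriods.HyperbolicBloch.ZagierDilogarithm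

/-! ## §1 Kummer's certificate inside the relator group -/

-- adapted from Cruxes/ZagierDilogarithmConjecture/SketchIdeator1.lean §B
/-- The complex conjugate of an algebraic number is algebraic. [folklore] -/
theorem isAlgebraic_conj {x : ℂ} (hx : IsAlgebraic ℚ x) : IsAlgebraic ℚ (conj x) := by
  simpa using hx.algHom (starRingEnd ℂ).toRatAlgHom

-- adapted from Cruxes/ZagierDilogarithmConjecture/SketchIdeator1.lean §B
/-- **Kummer's relation inside the relator group.** For algebraic `z ∉ ℝ`,
`2[z] − [z/z̄] − [(1 − z⁻¹)/(1 − z̄⁻¹)] − [(1 − z̄)/(1 − z)]` lies in the subgroup generated by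
`dilogRelators`: it is the five-term relator at `(x, y) = (z, z̄)` plus `[z] + [z̄]` minus
`[u₁] + [ū₁]` minus `[u₃] + [ū₃]` (`u₁ = z/z̄`, `u₃ = (1 − z̄)/(1 − z)`, so `ū₁ = z̄/z`,
`ū₃ = (1 − z)/(1 − z̄)`). Its `D`-shadow is Kummer's relation
`2D(z) = D(z/z̄) + D((1−1/z)/(1−1/z̄)) + D((1/(1−z))/(1/(1−z̄)))`.
[cite: Zagier2007Dilogarithm, Ch. I §3] -/
theorem kummer_mem_closure {z : ℂ} (hz : IsAlgebraic ℚ z) (him : z.im ≠ 0) :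
    2 • FreeAbelianGroup.of z - FreeAbelianGroup.of (z / conj z) -
        FreeAbelianGroup.of ((1 - z⁻¹) / (1 - (conj z)⁻¹)) -
        FreeAbelianGroup.of ((1 - conj z) / (1 - z)) ∈ AddSubgroup.closure dilogRelators := by
  have hz0 : z ≠ 0 := fun h => him (by simp [h])
  have hz1 : z ≠ 1 := fun h => him (by simp [h])
  have hzb0 : conj z ≠ 0 := by simpa using (map_ne_zero (starRingEnd ℂ)).2 hz0
  have hzb1 : conj z ≠ 1 := by
    intro h; apply hz1
    have := congrArg conj h
    simpa using this
  have hzz : z ≠ conj z := by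
    intro h
    have := congrArg Complex.im h
    simp only [Complex.conj_im] at this
    exact him (by linarith)
  have hzb : IsAlgebraic ℚ (conj z) := isAlgebraic_conj hz
  -- the four relators
  have hFT := AddSubgroup.subset_closure (fiveTerm_mem_dilogRelators hz hzb hz0 hz1 hzb0 hzb1 hzz)
  have hS0 := AddSubgroup.subset_closure (of_add_of_conj_mem_dilogRelators hz)
  have hu1 : IsAlgebraic ℚ (z / conj z) := hz.mul hzb.inv
  have hu3 : IsAlgebraic ℚ ((1 - conj z) / (1 - z)) :=
    (isAlgebraic_one.sub hzb).mul (isAlgebraic_one.sub hz).inv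
  have hS1 := AddSubgroup.subset_closure (of_add_of_conj_mem_dilogRelators hu1)
  have hS3 := AddSubgroup.subset_closure (of_add_of_conj_mem_dilogRelators hu3)
  -- conj of the unimodular arguments
  have e1 : (starRingEnd ℂ) (z / conj z) = conj z / z := by
    rw [map_div₀, Complex.conj_conj]
  have e3 : (starRingEnd ℂ) ((1 - conj z) / (1 - z)) = (1 - z) / (1 - conj z) := by
    rw [map_div₀, map_sub, map_sub, map_one, Complex.conj_conj]
  rw [e1] at hS1
  rw [e3] at hS3
  have key : 2 • FreeAbelianGroup.of z - FreeAbelianGroup.of (z / conj z) -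
        FreeAbelianGroup.of ((1 - z⁻¹) / (1 - (conj z)⁻¹)) -
        FreeAbelianGroup.of ((1 - conj z) / (1 - z)) =
      (FreeAbelianGroup.of z - FreeAbelianGroup.of (conj z) + FreeAbelianGroup.of (conj z / z) -
          FreeAbelianGroup.of ((1 - z⁻¹) / (1 - (conj z)⁻¹)) +
          FreeAbelianGroup.of ((1 - z) / (1 - conj z))) +
        (FreeAbelianGroup.of z + FreeAbelianGroup.of (conj z)) -
        (FreeAbelianGroup.of (z / conj z) + FreeAbelianGroup.of (conj z / z)) -
        (FreeAbelianGroup.of ((1 - conj z) / (1 - z)) +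
          FreeAbelianGroup.of ((1 - z) / (1 - conj z))) := by
    abel
  rw [key]
  exact AddSubgroup.sub_mem _ (AddSubgroup.sub_mem _ (AddSubgroup.add_mem _ hFT hS0) hS1) hS3

/-! ## §2 Normalisation of unimodular symbols to the upper half plane -/

/-- `‖v / v̄‖ = 1` for `v ≠ 0`. [folklore] -/
theorem norm_div_conj {v : ℂ} (hv : v ≠ 0) : ‖v / conj v‖ = 1 := by
  rw [norm_div, Complex.norm_conj, div_self (norm_ne_zero_iff.2 hv)]

/-- `‖v̄ / v‖ = 1` for `v ≠ 0`. [folklore] -/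
theorem norm_conj_div {v : ℂ} (hv : v ≠ 0) : ‖conj v / v‖ = 1 := by
  rw [norm_div, Complex.norm_conj, div_self (norm_ne_zero_iff.2 hv)]

/-- **Normalisation to `ℍ⁺`.** For a unimodular algebraic `u` there are a unimodular algebraic
`w` with `Im w > 0` and `ε ∈ {0, ±1}` with `[u] − ε[w] ∈ ⟨dilogRelators⟩`: `w = u`, `ε = 1` if
`Im u > 0`; `w = ū`, `ε = −1` if `Im u < 0` (`[u] + [ū]` is a relator); `w = i`, `ε = 0` if `u` is
real (`[u]` is a relator). [folklore] -/
theorem exists_normalised {u : ℂ} (hu : IsAlgebraic ℚ u) (hn : ‖u‖ = 1) :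
    ∃ (w : ℂ) (ε : ℤ), IsAlgebraic ℚ w ∧ 0 < w.im ∧ ‖w‖ = 1 ∧
      FreeAbelianGroup.of u - ε • FreeAbelianGroup.of w ∈ AddSubgroup.closure dilogRelators := by
  rcases lt_trichotomy 0 u.im with h | h | h
  · exact ⟨u, 1, hu, h, hn, by rw [one_zsmul, sub_self]; exact zero_mem _⟩
  · refine ⟨Complex.I, 0, ?_, by simp, by simp, ?_⟩
    · exact ⟨Polynomial.X ^ 2 + 1, Polynomial.X_pow_add_C_ne_zero (by norm_num) 1, by simp⟩
    · rw [zero_zsmul, sub_zero]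
      exact AddSubgroup.subset_closure (of_real_mem_dilogRelators h.symm)
  · refine ⟨conj u, -1, isAlgebraic_conj hu, ?_, ?_, ?_⟩
    · rw [Complex.conj_im]; linarith
    · rw [Complex.norm_conj]; exact hn
    · rw [neg_one_zsmul, sub_neg_eq_add]
      exact AddSubgroup.subset_closure (of_add_of_conj_mem_dilogRelators hu)

/-- **Kummer's certificate, normalised.** For algebraic `z ∉ ℝ` there are three unimodular
algebraic points `w₀, w₁, w₂ ∈ ℍ⁺` and `εₐ ∈ {0, ±1}` with `2[z] − Σₐ εₐ[wₐ] ∈ ⟨dilogRelators⟩`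
(Kummer's three arguments `z/z̄`, `(1 − z⁻¹)/(1 − z̄⁻¹)`, `(1 − z̄)/(1 − z)` are algebraic of
modulus one; normalise each by `exists_normalised`). [cite: Zagier2007Dilogarithm, Ch. I §3] -/
theorem exists_kummer_normalised {z : ℂ} (hz : IsAlgebraic ℚ z) (him : z.im ≠ 0) :
    ∃ (w : Fin 3 → ℂ) (ε : Fin 3 → ℤ), (∀ a, IsAlgebraic ℚ (w a)) ∧ (∀ a, 0 < (w a).im) ∧
      (∀ a, ‖w a‖ = 1) ∧
      2 • FreeAbelianGroup.of z - ∑ a, ε a • FreeAbelianGroup.of (w a) ∈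
        AddSubgroup.closure dilogRelators := by
  have hz0 : z ≠ 0 := fun h => him (by simp [h])
  have hz1 : z ≠ 1 := fun h => him (by simp [h])
  have hzb : IsAlgebraic ℚ (conj z) := isAlgebraic_conj hz
  have h1z : (1 : ℂ) - z ≠ 0 := sub_ne_zero.2 (Ne.symm hz1)
  have h1zi : (1 : ℂ) - z⁻¹ ≠ 0 := sub_ne_zero.2 (Ne.symm fun h => hz1 (inv_eq_one.1 h))
  -- algebraicity of Kummer's three arguments
  have ha1 : IsAlgebraic ℚ (z / conj z) := by
    rw [div_eq_mul_inv]; exact hz.mul hzb.inv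
  have ha2 : IsAlgebraic ℚ ((1 - z⁻¹) / (1 - (conj z)⁻¹)) := by
    rw [div_eq_mul_inv]
    exact (isAlgebraic_one.sub hz.inv).mul (isAlgebraic_one.sub hzb.inv).inv
  have ha3 : IsAlgebraic ℚ ((1 - conj z) / (1 - z)) := by
    rw [div_eq_mul_inv]; exact (isAlgebraic_one.sub hzb).mul (isAlgebraic_one.sub hz).inv
  -- unimodularity of Kummer's three arguments
  have hn1 : ‖z / conj z‖ = 1 := norm_div_conj hz0
  have hn2 : ‖(1 - z⁻¹) / (1 - (conj z)⁻¹)‖ = 1 := by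
    have e : 1 - (conj z)⁻¹ = conj (1 - z⁻¹) := by rw [map_sub, map_one, map_inv₀]
    rw [e]; exact norm_div_conj h1zi
  have hn3 : ‖(1 - conj z) / (1 - z)‖ = 1 := by
    have e : 1 - conj z = conj (1 - z) := by rw [map_sub, map_one]
    rw [e]; exact norm_conj_div h1z
  obtain ⟨w₁, ε₁, hw₁, hi₁, hm₁, hc₁⟩ := exists_normalised ha1 hn1
  obtain ⟨w₂, ε₂, hw₂, hi₂, hm₂, hc₂⟩ := exists_normalised ha2 hn2
  obtain ⟨w₃, ε₃, hw₃, hi₃, hm₃, hc₃⟩ := exists_normalised ha3 hn3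
  refine ⟨![w₁, w₂, w₃], ![ε₁, ε₂, ε₃], ?_, ?_, ?_, ?_⟩
  · intro a; fin_cases a; exacts [hw₁, hw₂, hw₃]
  · intro a; fin_cases a; exacts [hi₁, hi₂, hi₃]
  · intro a; fin_cases a; exacts [hm₁, hm₂, hm₃]
  · have key : 2 • FreeAbelianGroup.of z -
          ∑ a, (![ε₁, ε₂, ε₃] a) • FreeAbelianGroup.of (![w₁, w₂, w₃] a) =
        (2 • FreeAbelianGroup.of z - FreeAbelianGroup.of (z / conj z) -
            FreeAbelianGroup.of ((1 - z⁻¹) / (1 - (conj z)⁻¹)) -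
            FreeAbelianGroup.of ((1 - conj z) / (1 - z))) +
          (FreeAbelianGroup.of (z / conj z) - ε₁ • FreeAbelianGroup.of w₁) +
          (FreeAbelianGroup.of ((1 - z⁻¹) / (1 - (conj z)⁻¹)) - ε₂ • FreeAbelianGroup.of w₂) +
          (FreeAbelianGroup.of ((1 - conj z) / (1 - z)) - ε₃ • FreeAbelianGroup.of w₃) := by
      rw [Fin.sum_univ_three]
      simp only [Matrix.cons_val_zero, Matrix.cons_val_one, Matrix.cons_val_two,
        Matrix.head_cons, Matrix.tail_cons]
      abel
    rw [key]
    exact add_mem (add_mem (add_mem (kummer_mem_closure hz him) hc₁) hc₂) hc₃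

/-! ## §3 Soundness: the value homomorphism kills the relator group -/

-- adapted from Cruxes/ZagierDilogarithmConjecture/SketchIdeator1.lean §B
/-- `D((1 − w)⁻¹) = D(w)` (rotation of order three about `e^{iπ/3}`). [folklore] -/
theorem bw_inv_one_sub (w : ℂ) : blochWignerDilog (1 - w)⁻¹ = blochWignerDilog w := by
  rw [blochWignerDilog_inv, blochWignerDilog_one_sub, neg_neg]

-- adapted from Cruxes/ZagierDilogarithmConjecture/SketchIdeator1.lean §B
/-- **Neumann's form of the five-term relation for `D`:**
`D(x) − D(y) + D(y/x) − D((1−x⁻¹)/(1−y⁻¹)) + D((1−x)/(1−y)) = 0` for `x, y ∉ {0,1}`, `x ≠ y` — it is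
minus `blochWignerDilog_five_term` at `(a, b) = (y, x⁻¹)` rewritten with `D(w⁻¹) = −D(w)`,
`D(1 − w) = −D(w)`, `D((1 − w)⁻¹) = D(w)`. [cite: Neumann1998, §2 eq. (2.3)] -/
theorem five_term_neumann {x y : ℂ} (hx0 : x ≠ 0) (hx1 : x ≠ 1) (hy0 : y ≠ 0) (hy1 : y ≠ 1)
    (hxy : x ≠ y) :
    blochWignerDilog x - blochWignerDilog y + blochWignerDilog (y / x) -
        blochWignerDilog ((1 - x⁻¹) / (1 - y⁻¹)) + blochWignerDilog ((1 - x) / (1 - y)) = 0 := by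
  have hb0 : x⁻¹ ≠ 0 := inv_ne_zero hx0
  have hb1 : x⁻¹ ≠ 1 := by
    intro h; apply hx1; simpa using congrArg (·⁻¹) h
  have hab : y * x⁻¹ ≠ 1 := by
    intro h; apply hxy
    have : y = x := by
      field_simp at h
      linear_combination h
    exact this.symm
  have h := blochWignerDilog_five_term hy0 hy1 hb0 hb1 hab
  have hx1' : (1 : ℂ) - x ≠ 0 := sub_ne_zero.2 (Ne.symm hx1)
  have hy1' : (1 : ℂ) - y ≠ 0 := sub_ne_zero.2 (Ne.symm hy1)
  have hxy' : x - y ≠ 0 := sub_ne_zero.2 hxy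
  have hyx' : y - x ≠ 0 := sub_ne_zero.2 (Ne.symm hxy)
  have e1 : (1 - y) / (1 - y * x⁻¹) = (1 - (1 - x⁻¹) / (1 - y⁻¹))⁻¹ := by
    rw [eq_comm, inv_eq_iff_eq_inv, inv_div]
    field_simp
    ring
  have e2 : (1 - x⁻¹) / (1 - y * x⁻¹) = (1 - ((1 - x) / (1 - y))⁻¹)⁻¹ := by
    rw [eq_comm, inv_eq_iff_eq_inv, inv_div, inv_div]
    field_simp
    ring
  have e3 : 1 - y * x⁻¹ = 1 - y / x := by rw [div_eq_mul_inv]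
  rw [e1, e2, e3, bw_inv_one_sub, bw_inv_one_sub, blochWignerDilog_inv, blochWignerDilog_inv,
    blochWignerDilog_one_sub] at h
  linear_combination -h

-- adapted from Cruxes/ZagierDilogarithmConjecture/SketchIdeator1.lean §B (`dValue` inlined)
/-- **Soundness of the relator group:** the value homomorphism `ℤ[ℂ] → ℝ`, `[w] ↦ D(w)`
(`FreeAbelianGroup.lift blochWignerDilog`) vanishes on `⟨dilogRelators⟩` — five-term relators by
`five_term_neumann`, `[w] + [w̄]` by `D(w̄) = −D(w)`, real `[w]` by `D|_ℝ = 0`.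
[cite: Neumann1998, §2 eq. (2.3)] -/
theorem lift_eq_zero_of_mem_closure {c : FreeAbelianGroup ℂ}
    (hc : c ∈ AddSubgroup.closure dilogRelators) :
    FreeAbelianGroup.lift blochWignerDilog c = 0 := by
  refine (AddSubgroup.closure_le (K := (FreeAbelianGroup.lift blochWignerDilog).ker)).2 ?_ hc
  rintro r ((⟨x, y, -, -, hx0, hx1, hy0, hy1, hxy, rfl⟩ | ⟨w, -, rfl⟩) | ⟨w, hw, rfl⟩)
  · simp only [AddMonoidHom.mem_ker, map_add, map_sub, FreeAbelianGroup.lift_apply_of,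
      SetLike.mem_coe]
    exact five_term_neumann hx0 hx1 hy0 hy1 hxy
  · simp only [AddMonoidHom.mem_ker, map_add, FreeAbelianGroup.lift_apply_of, SetLike.mem_coe,
      blochWignerDilog_conj', add_neg_cancel]
  · simp only [AddMonoidHom.mem_ker, FreeAbelianGroup.lift_apply_of, SetLike.mem_coe,
      blochWignerDilog_of_im_eq_zero hw]

/-- The value of `Σ mᵢ[uᵢ]` is `Σ mᵢ D(uᵢ)`. [folklore] -/
theorem lift_sum_zsmul_of {ι : Type*} [Fintype ι] (u : ι → ℂ) (m : ι → ℤ) :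
    FreeAbelianGroup.lift blochWignerDilog (∑ i, m i • FreeAbelianGroup.of (u i)) =
      ∑ i, (m i : ℝ) * blochWignerDilog (u i) := by
  simp only [map_sum, map_zsmul, FreeAbelianGroup.lift_apply_of]
  simp only [zsmul_eq_mul]

/-! ## §4 The transfer -/

/-- The Clausen (unit-circle) form of Zagier's conjecture, stated for `Fin k`-indexed families,
transported to families indexed by an arbitrary finite type (reindex along `Fintype.equivFin`).
[folklore] -/
theorem clausen_fintype
    (hC : ∀ (k : ℕ) (u : Fin k → ℂ) (m : Fin k → ℤ), (∀ i, IsAlgebraic ℚ (u i)) →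
        (∀ i, 0 < (u i).im) → (∀ i, ‖u i‖ = 1) →
        ∑ i, (m i : ℝ) * blochWignerDilog (u i) = 0 →
          (∑ i, m i • FreeAbelianGroup.of (u i)) ∈ AddSubgroup.closure dilogRelators)
    {ι : Type*} [Fintype ι] (u : ι → ℂ) (m : ι → ℤ) (hu : ∀ i, IsAlgebraic ℚ (u i))
    (him : ∀ i, 0 < (u i).im) (hn : ∀ i, ‖u i‖ = 1)
    (hsum : ∑ i, (m i : ℝ) * blochWignerDilog (u i) = 0) :
    (∑ i, m i • FreeAbelianGroup.of (u i)) ∈ AddSubgroup.closure dilogRelators := by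
  classical
  have key : ∑ i, m i • FreeAbelianGroup.of (u i) =
      ∑ j, (m ∘ (Fintype.equivFin ι).symm) j •
        FreeAbelianGroup.of ((u ∘ (Fintype.equivFin ι).symm) j) :=
    ((Fintype.equivFin ι).symm.sum_comp (fun i => m i • FreeAbelianGroup.of (u i))).symm
  rw [key]
  refine hC _ _ _ (fun j => hu _) (fun j => him _) (fun j => hn _) ?_
  have key' : ∑ j, ((m ∘ (Fintype.equivFin ι).symm) j : ℝ) *
        blochWignerDilog ((u ∘ (Fintype.equivFin ι).symm) j) =
      ∑ i, (m i : ℝ) * blochWignerDilog (u i) :=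
    (Fintype.equivFin ι).symm.sum_comp (fun i => (m i : ℝ) * blochWignerDilog (u i))
  rw [key', hsum]

/-- Bookkeeping in `ℤ[ℂ]`: `2X − Y = Σᵢ nᵢ(2[zᵢ] − Σₐ εᵢₐ[wᵢₐ])` for `X = Σᵢ nᵢ[zᵢ]` and
`Y = Σ₍ᵢ,ₐ₎ nᵢεᵢₐ[wᵢₐ]`. [folklore] -/
theorem two_nsmul_sum_sub_sum_prod {ι κ A : Type*} [Fintype ι] [Fintype κ] [AddCommGroup A]
    (n : ι → ℤ) (x : ι → A) (ε : ι → κ → ℤ) (y : ι → κ → A) :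
    2 • ∑ i, n i • x i - ∑ p : ι × κ, (n p.1 * ε p.1 p.2) • y p.1 p.2 =
      ∑ i, n i • (2 • x i - ∑ a, ε i a • y i a) := by
  rw [Fintype.sum_prod_type, Finset.smul_sum, ← Finset.sum_sub_distrib]
  refine Finset.sum_congr rfl fun i _ => ?_
  rw [smul_sub, Finset.smul_sum, smul_comm (2 : ℕ) (n i) (x i)]
  simp only [mul_smul]

/-- **Stub `stub_kummerDescent` (Kummer descent / transfer).** If the relator group
`⟨dilogRelators⟩ ⊆ ℤ[ℂ]` is 2-saturated and Zagier's conjecture holds in its Clausen (unit-circle)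
form — for algebraic `uⱼ` of modulus one in the upper half plane, `Σ mⱼ D(uⱼ) = 0` implies
`Σ mⱼ[uⱼ] ∈ ⟨dilogRelators⟩` — then Zagier's conjecture `ZagierDilogarithmRelationsConjecture`
holds: by Kummer's relation every `2[zᵢ]` is, modulo relators, a signed sum of three unimodular
algebraic symbols in `ℍ⁺`; the resulting combination has vanishing `D`-sum (soundness), so the
Clausen form puts it in the relator group, whence `2 Σ nᵢ[zᵢ]` is there, and one divides by `2`.
[cite: Zagier2007Dilogarithm, Ch. I §3] -/
theorem stub_kummerDescent :
    (∀ x : FreeAbelianGroup ℂ, 2 • x ∈ AddSubgroup.closure dilogRelators →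
        x ∈ AddSubgroup.closure dilogRelators) →
    (∀ (k : ℕ) (u : Fin k → ℂ) (m : Fin k → ℤ), (∀ i, IsAlgebraic ℚ (u i)) →
        (∀ i, 0 < (u i).im) → (∀ i, ‖u i‖ = 1) →
        ∑ i, (m i : ℝ) * blochWignerDilog (u i) = 0 →
          (∑ i, m i • FreeAbelianGroup.of (u i)) ∈ AddSubgroup.closure dilogRelators) →
    ZagierDilogarithmRelationsConjecture := by
  intro h2 hC
  rw [ZagierDilogarithmRelationsConjecture.iff_blochWignerDilog']
  intro k z n hz him hsum
  choose w ε hw hiw hnw hmem using fun i => exists_kummer_normalised (hz i) (him i).ne'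
  -- `E = 2X − Y ∈ C`, `Y` the normalised unimodular family indexed by `Fin k × Fin 3`
  have hE : 2 • ∑ i, n i • FreeAbelianGroup.of (z i) -
      ∑ p : Fin k × Fin 3, (n p.1 * ε p.1 p.2) • FreeAbelianGroup.of (w p.1 p.2) ∈
        AddSubgroup.closure dilogRelators := by
    rw [two_nsmul_sum_sub_sum_prod n (fun i => FreeAbelianGroup.of (z i)) ε
      (fun i a => FreeAbelianGroup.of (w i a))]
    exact sum_mem fun i _ => zsmul_mem (hmem i) _
  -- soundness: the `D`-sum of `Y` vanishes
  have hYval : ∑ p : Fin k × Fin 3, ((n p.1 * ε p.1 p.2 : ℤ) : ℝ) *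
      blochWignerDilog (w p.1 p.2) = 0 := by
    have h1 := lift_eq_zero_of_mem_closure hE
    rw [map_sub, map_nsmul, lift_sum_zsmul_of, hsum, smul_zero, zero_sub, neg_eq_zero,
      lift_sum_zsmul_of (fun p : Fin k × Fin 3 => w p.1 p.2) (fun p => n p.1 * ε p.1 p.2)] at h1
    exact h1
  -- the Clausen form: `Y ∈ C`
  have hY : ∑ p : Fin k × Fin 3, (n p.1 * ε p.1 p.2) • FreeAbelianGroup.of (w p.1 p.2) ∈
      AddSubgroup.closure dilogRelators :=
    clausen_fintype hC (fun p : Fin k × Fin 3 => w p.1 p.2) (fun p => n p.1 * ε p.1 p.2)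
      (fun p => hw _ _) (fun p => hiw _ _) (fun p => hnw _ _) hYval
  -- `2X = (2X − Y) + Y ∈ C`; divide by `2`
  refine h2 _ ?_
  rw [← sub_add_cancel (2 • ∑ i, n i • FreeAbelianGroup.of (z i))
    (∑ p : Fin k × Fin 3, (n p.1 * ε p.1 p.2) • FreeAbelianGroup.of (w p.1 p.2))]
  exact add_mem hE hY

end Summit.KontsevichZagierPeriods.HyperbolicBloch.ZagierDilogarithm

end
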